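import Summits.CriticalPhenomena.PercolationContinuityZ3.Theorems.PercNearOneGluingNoHeavyLowerTailTIncSwitching
import Mathlib.Tactic.FinCases
import Mathlib.Tactic.Linarith
import HarnessLib

/-!
# `NoHeavyLowerTail` (stmt-CriticalPhenomena-4575) — (TB1), (TB2): the apex-edge (indeed ANY-edge) Bernstein pieces of `T_inc` are
# nonnegative on every finite weighted graph — by FIBREWISE positivity of the tree's five-switching certificate for `T_inc`

Support file (prover prim-l12-p6 gen 3, route-task `l12-p6`; `--supports stmt-CriticalPhenomena-4575`).  No named facts, no sorries,
no definitions (the fibre indicator `1[#{j : e ∈ x j} = k]` is written inline).  Answers ttrl request l.640 / cp-hms `TINC-BERNSTEIN.md` (0 violations of (TB1),(TB2) in 230 M apex steps,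
n ≤ 8) and prim-e3grp-switch-3's `StepHypT` question with a PROOF, and explains the census on every edge class (`BERNSTEIN-PIECES.md`).

THE OBSERVATION.  prim-e3grp-switch-1's certificate I5 for `T_inc ≥ 0` (`TIncSwitching.certI5_nonpos`: pointwise `S ≤ 0` on triples of
configurations; `E[S] = −T_inc`) uses five switchings `Φ₂(a), Φ₂(c), Ψ₃(a,c), Ψ₄(b,c), Φ₃(c,a)` that are EXCHANGES: at every pair the three
output bits are a permutation of the three input bits (`DecisionTree.PermutesCopies`, here `permutesCopies_phi2/phi3/psi3/psi4`).  Hence for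
every pair `e` and every `k` the fibre `U_k(e) = {x : e lies in exactly k of the three copies}` is invariant (`card_filter_mem_eq_of_permutesCopies`),
each switching preserves the triple law restricted to the fibre (`sum_wt3W_fib_comp`), and so `Σ_{x ∈ U_k(e)} wt3W(x)·S(x) ≤ 0` can be
evaluated exactly like `E[S]`: splitting the three bits of `e` (`DTree3.sum_triples_split`) and factorising boxes off `e` (`sum_wt3W_fib_ind_box`,
`fibre_box_one/two`) gives `p_e^k(1−p_e)^{3−k} · Σ_{|b|=k} F_cert(law^{b₀}, law^{b₁}, law^{b₂})`, where `F_cert` is the trilinear form of the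
ten boxes of I5 (diagonal `−T_inc`) and `law^β` is the three-point law of `S ↦ S` (`β = 0`) resp. `S ↦ S ∪ {e}` (`β = 1`) under `PrW_{D∖e}`.
The sum over the three patterns with one (two) glued copy is the (2,1)- (resp. (1,2)-) POLARISATION of the cubic `T_inc`, i.e. `−threeTB₁`
(resp. `−threeTB₂`) of `…CubicThreePointTincInduction` — polarisation is blind to the asymmetry of the certificate.  So the pointwise
certificate proves much more than `T_inc ≥ 0`: ALL Bernstein coefficients of `T_inc` along EVERY one-edge pencil are `≥ 0`.
(The same remark applied to prim-cert-2's four exchanges for 3PT-LB gives `BernsteinPieceB1/B2` of `F = SHK3⁺` in one page; it fails for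
`H_{q+t}`, which has no exchange certificate — consistent with the 5-point obstruction found for (BH1),(BH2).)

RESULTS (all `p ∈ [0,1]`, any finite `V`, any `D`, any `a b c`, any pair `e`):
* `polar_one_nonneg`, `polar_two_nonneg` (`e ∈ D`): `0 ≤ p_e(1−p_e)²·P12`, `0 ≤ p_e²(1−p_e)·P21` at the cells of `PrW_{D∖e}{S | ins e β S ∈ ·}`;
* `tincPolar12_nonneg`, `tincPolar21_nonneg` (`e ∉ D`, the clean gluing pencil `law(D) → law(D, e forced)`): `0 ≤ P12(c⁰;c¹)`, `0 ≤ P21(c⁰;c¹)`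
  with `c⁰ = (q, u_a, u_b, u_c, t)` the cells of `PrW D p` on `a|b|c, bc|a, ac|b, ab|c, abc` and `c¹` the cells of `S ↦ S ∪ {e}` — the 46-term
  bi-forms `P12, P21` written out;
* `threeTB₁_eq_polar`, `threeTB₂_eq_polar` (`ring`): `P12(c⁰; c⁰+δ) = threeTB₁(c⁰,δ)`, `P21(c⁰; c⁰+δ) = threeTB₂(c⁰,δ)` for the five apex
  transition masses `δ = (α₁,α₂,β₁,β₂,β₃)`;
* `threeTB₁_nonneg_of_transitions`, `threeTB₂_nonneg_of_transitions`: **(TB1), (TB2)** — `0 ≤ threeTB₁`, `0 ≤ threeTB₂` at the cells of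
  `PrW D p` and any reals `α₁ … β₃` through which the glued cells decompose (`q¹ = q−α₁−α₂, u_c¹ = u_c+α₁−β₁, u_b¹ = u_b+α₂−β₂, u_a¹ = u_a−β₃,
  t¹ = t+β₁+β₂+β₃` — automatic for an apex pair `e ∋ a`, where adding `e` merges `a`'s cluster with one other cluster).
Cell bookkeeping for pushed-forward laws `S ↦ g S`: `push_univ/nPb/aiso/nab/biso/nbc/ab/bc`.  Companion algebra (event form of the pieces,
`3·TB1 − TB0 − TB3`): `…CubicThreePointTincBernsteinEventForm`.  Law-level context (this seat, FROM-prim-l12-p6-g3-TINC-BERNSTEIN.md): no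
multiplier certificate for (TB1)/(TB2) exists over the α-free proved four-point dictionary (strictly positive pseudo-laws), so a row-free
argument such as this one was needed.  [this work] (fibre refinement of an exchange-switching certificate; [cite: GladkovZimin2024, Lemma 4.2]
for the exchange property)
-/
noncomputable section

namespace Summit.CriticalPhenomena.PercolationContinuityZ3.Theorems

namespace TIncFibre

open Finset Literature.Probability.Percolation Literature.Probability.Percolation.DecisionTree
open Literature.Probability.Percolation.Gladkov ThreePointLB TIncSwitching
open Literature.Probability.Percolation.DecisionTree.DTree2 (ins wt1 mem_ins_self_iff)
open scoped Classical

variable {V : Type*} [Fintype V] [DecidableEq V]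

omit [Fintype V] in
/-- The number of copies of a triple `x` that contain the pair `e` is invariant under every edgewise
copy-permuting map. [folklore] -/
theorem card_filter_mem_eq_of_permutesCopies {Φ : (Fin 3 → Finset (Sym2 V)) → (Fin 3 → Finset (Sym2 V))}
    (hΦ : PermutesCopies Φ) (x : Fin 3 → Finset (Sym2 V)) (e : Sym2 V) :
    (univ.filter fun k => e ∈ Φ x k).card = (univ.filter fun k => e ∈ x k).card := by
  obtain ⟨π, hπ⟩ := hΦ x e
  have h : (univ.filter fun k => e ∈ Φ x k) = (univ.filter fun k => e ∈ x k).map π.symm.toEmbedding := by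
    ext k
    simp only [mem_filter, mem_univ, true_and, mem_map_equiv, Equiv.symm_symm, hπ k]
  rw [h, card_map]

/-- `Φ₂(v)` (one-cluster exchange of copies `0,2`) permutes the copies edgewise. [folklore] -/
theorem permutesCopies_phi2 (v : V) :
    PermutesCopies (phi2 v : (Fin 3 → Finset (Sym2 V)) → (Fin 3 → Finset (Sym2 V))) := by
  show PermutesCopies (splice3 (fun _ => (∅ : Finset (Sym2 V))) (fun K => touch (cl K v)))
  exact permutesCopies_splice3 fun K => Finset.disjoint_empty_right _

/-- `Φ₃(a,b)` (two successive cluster exchanges) permutes the copies edgewise. [folklore] -/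
theorem permutesCopies_phi3 (a b : V) :
    PermutesCopies (phi3 a b : (Fin 3 → Finset (Sym2 V)) → (Fin 3 → Finset (Sym2 V))) := by
  show PermutesCopies (splice3 (fun K => touch (cl K a)) (fun K => touch (cl K b) \ touch (cl K a)))
  exact permutesCopies_splice3 fun K => Finset.sdiff_disjoint

/-- `Ψ₃(a,c)` (reveal `K_a`, exchange copies `0,2` on the rest of `K_c`'s pairs) permutes the copies edgewise. [folklore] -/
theorem permutesCopies_psi3 (a c : V) :
    PermutesCopies (psi3 a c : (Fin 3 → Finset (Sym2 V)) → (Fin 3 → Finset (Sym2 V))) := by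
  intro x i
  by_cases hi : i ∈ touch (cl (x 0) c) \ touch (cl (x 0) a)
  · refine ⟨Equiv.swap 0 2, fun k => ?_⟩
    fin_cases k
    · simp [mem_splice_of_mem hi]
    · simp [Equiv.swap_apply_of_ne_of_ne]
    · simp [mem_splice_of_mem hi]
  · refine ⟨1, fun k => ?_⟩
    fin_cases k
    · simp [mem_splice_of_not_mem hi]
    · simp
    · simp [mem_splice_of_not_mem hi]

/-- `Ψ₄(b,c)` permutes the copies edgewise. [folklore] -/
theorem permutesCopies_psi4 (b c : V) :
    PermutesCopies (psi4 b c : (Fin 3 → Finset (Sym2 V)) → (Fin 3 → Finset (Sym2 V))) := by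
  intro x i
  by_cases hi : i ∈ touch (cl (x 0) c) \ touch (cl (x 0) b)
  · refine ⟨Equiv.swap 0 1, fun k => ?_⟩
    fin_cases k
    · simp [mem_splice_of_mem hi]
    · simp [mem_splice_of_mem hi]
    · simp [Equiv.swap_apply_of_ne_of_ne]
  · refine ⟨1, fun k => ?_⟩
    fin_cases k
    · simp [mem_splice_of_not_mem hi]
    · simp [mem_splice_of_not_mem hi]
    · simp

/-! ### Fibres of one pair are invariant, so the switchings preserve the law restricted to a fibre -/

section Fibre

variable (p : Sym2 V → ℝ) (D : Finset (Sym2 V)) (e : Sym2 V) (k : ℕ)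

omit [Fintype V] in
/-- `fib ≥ 0`. [folklore] -/
theorem fib_nonneg (x : Fin 3 → Finset (Sym2 V)) : 0 ≤ (if (univ.filter fun j => e ∈ x j).card = k then (1 : ℝ) else 0) := by
  split_ifs <;> norm_num

omit [Fintype V] in
/-- The fibre indicator is invariant under edgewise copy-permuting maps. [folklore] -/
theorem fib_comp {Φ : (Fin 3 → Finset (Sym2 V)) → (Fin 3 → Finset (Sym2 V))} (hΦ : PermutesCopies Φ)
    (x : Fin 3 → Finset (Sym2 V)) : (if (univ.filter fun j => e ∈ Φ x j).card = k then (1 : ℝ) else 0) = (if (univ.filter fun j => e ∈ x j).card = k then (1 : ℝ) else 0) := by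
  rw [card_filter_mem_eq_of_permutesCopies hΦ]

omit [Fintype V] in
/-- A law-preserving, edgewise copy-permuting switching preserves the law restricted to every fibre of `e`:
`Σ_x wt3W x · fib (x) · g (Φ x) = Σ_x wt3W x · fib x · g x`. [folklore] -/
theorem sum_wt3W_fib_comp {Φ : (Fin 3 → Finset (Sym2 V)) → (Fin 3 → Finset (Sym2 V))} (hΦ : PermutesCopies Φ)
    (hsum : ∀ f : (Fin 3 → Finset (Sym2 V)) → ℝ,
      ∑ x ∈ triples D, wt3W D p x * f (Φ x) = ∑ x ∈ triples D, wt3W D p x * f x)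
    (g : (Fin 3 → Finset (Sym2 V)) → ℝ) :
    ∑ x ∈ triples D, wt3W D p x * (if (univ.filter fun j => e ∈ x j).card = k then (1 : ℝ) else 0) * g (Φ x) = ∑ x ∈ triples D, wt3W D p x * (if (univ.filter fun j => e ∈ x j).card = k then (1 : ℝ) else 0) * g x := by
  have h := hsum (fun y => (if (univ.filter fun j => e ∈ y j).card = k then (1 : ℝ) else 0) * g y)
  simp only [fib_comp e k hΦ] at h
  simpa only [mul_assoc] using h

end Fibre


/-! ### Splitting a fibre box sum along the pair `e` -/

section Split

variable (p : Sym2 V → ℝ) (D : Finset (Sym2 V)) {e : Sym2 V} (k : ℕ)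

omit [Fintype V] in
/-- A fibre box sum splits along `e`: the three bits of `e` are independent of the rest, the fibre fixes their
number of ones, and off `e` the box factorises. [folklore] -/
theorem sum_wt3W_fib_ind_box (he : e ∈ D) (E₀ E₁ E₂ : Set (Finset (Sym2 V))) :
    ∑ x ∈ triples D, wt3W D p x * (if (univ.filter fun j => e ∈ x j).card = k then (1 : ℝ) else 0) * ind (box E₀ E₁ E₂) x =
      ∑ b : Fin 3 → Bool, (∏ i, wt1 p e (b i)) *
        ((if (univ.filter fun j => b j = true).card = k then (1 : ℝ) else 0) *
          (PrW (D.erase e) p {S | ins e (b 0) S ∈ E₀} * PrW (D.erase e) p {S | ins e (b 1) S ∈ E₁} *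
            PrW (D.erase e) p {S | ins e (b 2) S ∈ E₂})) := by
  have h := DTree3.sum_triples_split D p he (fun x => (if (univ.filter fun j => e ∈ x j).card = k then (1 : ℝ) else 0) * ind (box E₀ E₁ E₂) x)
  simp only [← mul_assoc] at h
  rw [h]
  refine Finset.sum_congr rfl fun b _ => ?_
  congr 1
  have hy : ∀ y ∈ triples (D.erase e), ∀ i, e ∉ y i := fun y hy i h' =>
    (Finset.notMem_erase e D) (mem_triples.1 hy i h')
  have h1 : ∀ y ∈ triples (D.erase e),
      wt3W (D.erase e) p y * (if (univ.filter fun j => e ∈ ins e (b j) (y j)).card = k then (1 : ℝ) else 0) * ind (box E₀ E₁ E₂) (fun i => ins e (b i) (y i)) =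
        (if (univ.filter fun j => b j = true).card = k then (1 : ℝ) else 0) *
          (wt3W (D.erase e) p y * ind (box {S | ins e (b 0) S ∈ E₀} {S | ins e (b 1) S ∈ E₁} {S | ins e (b 2) S ∈ E₂}) y) := by
    intro y hy'
    have hf : (if (univ.filter fun j => e ∈ ins e (b j) (y j)).card = k then (1 : ℝ) else 0) = if (univ.filter fun j => b j = true).card = k then (1 : ℝ) else 0 := by
      rw [Finset.filter_congr (fun j _ => mem_ins_self_iff (hy y hy' j))]
    have hi : ind (box E₀ E₁ E₂) (fun i => ins e (b i) (y i)) =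
        ind (box {S | ins e (b 0) S ∈ E₀} {S | ins e (b 1) S ∈ E₁} {S | ins e (b 2) S ∈ E₂}) y := by
      by_cases hm : (fun i => ins e (b i) (y i)) ∈ box E₀ E₁ E₂
      · rw [ind_of_mem hm, ind_of_mem (by simpa [mem_box] using hm)]
      · rw [ind_of_not_mem hm, ind_of_not_mem (by simpa [mem_box] using hm)]
    rw [hf, hi]; ring
  rw [Finset.sum_congr rfl h1, ← Finset.mul_sum, sum_wt3W_ind_box]

/-- Enumeration of `Fin 3 → Bool`. [folklore] -/
theorem univ_fin3_bool : (univ : Finset (Fin 3 → Bool)) =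
    {![true, false, false], ![false, true, false], ![false, false, true], ![true, true, false], ![true, false, true],
      ![false, true, true], ![false, false, false], ![true, true, true]} := by
  decide

/-- The pattern sum with exactly one `true`. [folklore] -/
theorem sum_pattern_one (w : Bool → ℝ) (P₀ P₁ P₂ : Bool → ℝ) :
    ∑ b : Fin 3 → Bool, (∏ i, w (b i)) *
        ((if (univ.filter fun j => b j = true).card = 1 then (1 : ℝ) else 0) * (P₀ (b 0) * P₁ (b 1) * P₂ (b 2))) =
      w true * w false * w false *
        (P₀ true * P₁ false * P₂ false + P₀ false * P₁ true * P₂ false + P₀ false * P₁ false * P₂ true) := by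
  rw [univ_fin3_bool]
  rw [sum_insert (by decide), sum_insert (by decide), sum_insert (by decide), sum_insert (by decide),
    sum_insert (by decide), sum_insert (by decide), sum_insert (by decide), sum_singleton]
  have c1 : (univ.filter fun j => (![true, false, false] : Fin 3 → Bool) j = true).card = 1 := by decide
  have c2 : (univ.filter fun j => (![false, true, false] : Fin 3 → Bool) j = true).card = 1 := by decide
  have c3 : (univ.filter fun j => (![false, false, true] : Fin 3 → Bool) j = true).card = 1 := by decide
  have c4 : (univ.filter fun j => (![true, true, false] : Fin 3 → Bool) j = true).card = 2 := by decide
  have c5 : (univ.filter fun j => (![true, false, true] : Fin 3 → Bool) j = true).card = 2 := by decide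
  have c6 : (univ.filter fun j => (![false, true, true] : Fin 3 → Bool) j = true).card = 2 := by decide
  have c7 : (univ.filter fun j => (![false, false, false] : Fin 3 → Bool) j = true).card = 0 := by decide
  have c8 : (univ.filter fun j => (![true, true, true] : Fin 3 → Bool) j = true).card = 3 := by decide
  simp only [c1, c2, c3, c4, c5, c6, c7, c8, Fin.prod_univ_three, Matrix.cons_val_zero, Matrix.cons_val_one,
    Matrix.cons_val_two, Matrix.head_cons, Matrix.tail_cons]
  norm_num
  ring

/-- The pattern sum with exactly two `true`s. [folklore] -/
theorem sum_pattern_two (w : Bool → ℝ) (P₀ P₁ P₂ : Bool → ℝ) :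
    ∑ b : Fin 3 → Bool, (∏ i, w (b i)) *
        ((if (univ.filter fun j => b j = true).card = 2 then (1 : ℝ) else 0) * (P₀ (b 0) * P₁ (b 1) * P₂ (b 2))) =
      w true * w true * w false *
        (P₀ true * P₁ true * P₂ false + P₀ true * P₁ false * P₂ true + P₀ false * P₁ true * P₂ true) := by
  rw [univ_fin3_bool]
  rw [sum_insert (by decide), sum_insert (by decide), sum_insert (by decide), sum_insert (by decide),
    sum_insert (by decide), sum_insert (by decide), sum_insert (by decide), sum_singleton]
  have c1 : (univ.filter fun j => (![true, false, false] : Fin 3 → Bool) j = true).card = 1 := by decide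
  have c2 : (univ.filter fun j => (![false, true, false] : Fin 3 → Bool) j = true).card = 1 := by decide
  have c3 : (univ.filter fun j => (![false, false, true] : Fin 3 → Bool) j = true).card = 1 := by decide
  have c4 : (univ.filter fun j => (![true, true, false] : Fin 3 → Bool) j = true).card = 2 := by decide
  have c5 : (univ.filter fun j => (![true, false, true] : Fin 3 → Bool) j = true).card = 2 := by decide
  have c6 : (univ.filter fun j => (![false, true, true] : Fin 3 → Bool) j = true).card = 2 := by decide
  have c7 : (univ.filter fun j => (![false, false, false] : Fin 3 → Bool) j = true).card = 0 := by decide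
  have c8 : (univ.filter fun j => (![true, true, true] : Fin 3 → Bool) j = true).card = 3 := by decide
  simp only [c1, c2, c3, c4, c5, c6, c7, c8, Fin.prod_univ_three, Matrix.cons_val_zero, Matrix.cons_val_one,
    Matrix.cons_val_two, Matrix.head_cons, Matrix.tail_cons]
  norm_num
  ring

omit [Fintype V] in
/-- The one-open fibre of a box: `Σ_x wt3W x · fib₁ x · 1_box(x) = p_e(1−p_e)² ·
(P¹P⁰P⁰ + P⁰P¹P⁰ + P⁰P⁰P¹)` with `P^β_i = PrW_{D∖e}{S | ins e β S ∈ Eᵢ}`. [folklore] -/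
theorem fibre_box_one (he : e ∈ D) (E₀ E₁ E₂ : Set (Finset (Sym2 V))) :
    ∑ x ∈ triples D, wt3W D p x * (if (univ.filter fun j => e ∈ x j).card = 1 then (1 : ℝ) else 0) * ind (box E₀ E₁ E₂) x =
      p e * (1 - p e) * (1 - p e) *
        (PrW (D.erase e) p {S | ins e true S ∈ E₀} * PrW (D.erase e) p {S | ins e false S ∈ E₁} * PrW (D.erase e) p {S | ins e false S ∈ E₂} +
          PrW (D.erase e) p {S | ins e false S ∈ E₀} * PrW (D.erase e) p {S | ins e true S ∈ E₁} * PrW (D.erase e) p {S | ins e false S ∈ E₂} +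
          PrW (D.erase e) p {S | ins e false S ∈ E₀} * PrW (D.erase e) p {S | ins e false S ∈ E₁} * PrW (D.erase e) p {S | ins e true S ∈ E₂}) := by
  rw [sum_wt3W_fib_ind_box p D 1 he,
    sum_pattern_one (wt1 p e) (fun β => PrW (D.erase e) p {S | ins e β S ∈ E₀}) (fun β => PrW (D.erase e) p {S | ins e β S ∈ E₁})
      (fun β => PrW (D.erase e) p {S | ins e β S ∈ E₂})]
  simp [wt1]

omit [Fintype V] in
/-- The two-open fibre of a box. [folklore] -/
theorem fibre_box_two (he : e ∈ D) (E₀ E₁ E₂ : Set (Finset (Sym2 V))) :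
    ∑ x ∈ triples D, wt3W D p x * (if (univ.filter fun j => e ∈ x j).card = 2 then (1 : ℝ) else 0) * ind (box E₀ E₁ E₂) x =
      p e * p e * (1 - p e) *
        (PrW (D.erase e) p {S | ins e true S ∈ E₀} * PrW (D.erase e) p {S | ins e true S ∈ E₁} * PrW (D.erase e) p {S | ins e false S ∈ E₂} +
          PrW (D.erase e) p {S | ins e true S ∈ E₀} * PrW (D.erase e) p {S | ins e false S ∈ E₁} * PrW (D.erase e) p {S | ins e true S ∈ E₂} +
          PrW (D.erase e) p {S | ins e false S ∈ E₀} * PrW (D.erase e) p {S | ins e true S ∈ E₁} * PrW (D.erase e) p {S | ins e true S ∈ E₂}) := by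
  rw [sum_wt3W_fib_ind_box p D 2 he,
    sum_pattern_two (wt1 p e) (fun β => PrW (D.erase e) p {S | ins e β S ∈ E₀}) (fun β => PrW (D.erase e) p {S | ins e β S ∈ E₁})
      (fun β => PrW (D.erase e) p {S | ins e β S ∈ E₂})]
  simp [wt1]

end Split

end TIncFibre

end Summit.CriticalPhenomena.PercolationContinuityZ3.Theorems

end
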